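import Mathlib
import HarnessLib
import HarnessLib.Audit
import Summits.KontsevichZagierPeriods.Statement
import HarnessLib.Audit.Status.Attr

/-!
Route: GenericPointClass

DORMANT since 2026-08-24T06:30:35Z (reconciler: no traction for 6.6 d (last activity item-proof-filed at 2026-08-17T16:03:03Z); parked, not closed — `ledger route dormant route-KontsevichZagierPeriods-GenericPointClass --off` to reactiv) — unstaffed, not closed; items shared with open routes are served there. `ledger route dormant <id> --off` reactivates.

# Route GenericPointClass — the de Rham class of the integrand at the generic point decides one-step
Newton–Leibniz descent — trace no-go downward (ζ(2)'s square is stuck), divergence rule upward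

Card realised: generic-point-class-one-step-descent (spine). THE OBSTRUCTION TO INTEGRATING OUT ONE
VARIABLE INSIDE THE
H21 CALCULUS IS A COHOMOLOGY CLASS, NOT "TRANSCENDENCE OF PRIMITIVES": for a representation r = [σ,
g] the class
c(r) = [g dx₁∧…∧dxₙ] ∈ Hⁿ_dR(ℚ(x)(g)/ℚ) (algebraic de Rham cohomology of the integrand's own
function field) vanishes
as soon as r descends by one change of variables and ONE Newton–Leibniz step in any Nash coordinate
system (Theorem A,
downward, by a trace argument), and conversely an explicit divergence g = Σ ∂ᵢAᵢ with semialgebraic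
potentials descends
in 1 + n moves (Theorem B, upward). It suffices to show X = X_B ∧ X_K: X_B = ExactDescentBox
(Theorem B on boxes:
Gauss–Ostrogradsky with ℚ-semialgebraic potentials is a DERIVED rule of the four moves — the engine,
theorem-candidate)
and X_K = DivergenceKernelConjecture (the period conjecture for the calculus enlarged by that
divergence rule — the open
core, summit-strength). Theorem A is filed as the typed no-go cruxes OneStepDescentExact (n = 2) and
OneStepDescentExactDimOne (n = 1) with the headline corollary ZetaTwoSquareStuck: ζ(2)'s square
∫∫_{(0,1)²} dxdy/(1−xy)
admits NO change-of-variables + single-Newton–Leibniz descent, because dxdy/(1−xy) = (dq/q)∧(dx/x),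
q = 1 − xy, is not
exact over ℚ(x,y) (HyperbolaFormNotExact) — the first rigorous chain-SHAPE theorem above dimension
1.
Lean: `ExactDescentBox ∧ DivergenceKernelConjecture`

## Assembly
Pure logic over a proved reduction (sorry-free `theorem assembly_proof` in the planner's
Sketch.lean): apply
DivergenceKernelConjecture at R := KZ.relations (le_rfl; closure under the box-divergence rule IS
ExactDescentBox) to get
∀ c, KZ.eval c = 0 → c ∈ KZ.relations, i.e.
Literature.NumberTheory.Transcendental.KZKernelConjecture, then
Summit.KontsevichZagierPeriods.KernelForm.kontsevichZagierPeriods_of_kzKernelConjecture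
(Theorems/KernelFormKernelImpliesStatement.lean). The no-go cruxes 2–3 are not hypotheses of the
Assembly: they are the
theorems that make the rule's domain of validity ({c = 0}) sharp.

Rationale: WHY THIS LINE. Ayoub2015 Rem. 1.2 / Fresan2024 Rem. 3.6 / CressonViusos2022 §2.1 (catalogued as
Literature.Barriers.KontsevichZagierPeriods.noSemialgebraicPrimitive_inv_sub_two) print ONE example
(1/(t−2), identity
coordinate, n = 1) defeating the holomorphic induction "integrate out the last variable"; the card
replaces the slogan by
a two-sided criterion valid in every dimension and every Nash coordinate system: Nash data are
algebraic over ℚ(x)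
(BasuPollackRoy2006 Prop. 2.86), the identity g dx∧dy = ±d((F∘Φ)dΦ₁) read off the move data holds in
a finite extension
L of ℚ(x,y), and (1/[L:ℚ(x,y)])·Tr commutes with d (Hartshorne1975; algebraic de Rham of function
fields,
BlochOgus1974 / AndreBaldassarri2001), so one-step descent forces exactness over ℚ(x,y) — decidable
by Griffiths–Dwork
pole reduction (Griffiths1969, BostanLairezSalvy2013, Lairez2015), non-vanishing witnessed by a
residue (Dimca1992 Ch. 6
Thm. 1.21, Ch. 2 (2.14): H²(𝔸²∖{xy=1}) ≅ H¹(𝔾_m) ≠ 0). Imported areas: algebraic de Rham cohomology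
at the generic
point (coniveau/residues) × real-algebraic geometry (Nash functions) × the H21 move calculus; no
spectral/probabilistic
reformulation applies. What it does that prior routes do not: LiouvilleUnfolding ENLARGES the
primitives (what to do
when c ≠ 0, n = 1), GaussManinCertificates derives Stokes with potentials VANISHING on the boundary,
LowDimension
stratifies by dimension with Baker — none proves a no-go on chain shape in dimension ≥ 2 or decides
when no enlargement
and no extra variable is needed; the negatives index is empty.

RANKED CRUXES. #2 OneStepDescentExact (crux) — Theorem A, n = 2, rational integrands (card N2): if
the KZ representation [(0,1)², p/q] (q ≠ 0 on the open square) is connected to a 1-dimensional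
representation by a chain null-modification → ONE change of variables (rule 2 in either orientation,
any ℚ-semialgebraic injective differentiable Φ, so any Nash coordinate system incl. permutations) →
null-modification → ONE Newton–Leibniz step (rule 3), then (p/q)·dx∧dy is exact over ℚ(x,y): p/q =
∂₀(A/D) + ∂₁(B/D), i.e. p·D² = q·(A₀D − A·D₀ + B₁D − B·D₁) for polynomials A, B, D ≠ 0 over ℚ.
Null-modifications (symmetric difference of domains Lebesgue-null, integrands equal on the
intersection) are exactly what rules (1a) with null pieces provide and are needed for non-vacuity
(rule 3 wants closed fibres, rule 2 maps open sets to open sets); e.g. [(0,1)², 1/(x+y+1)²]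
satisfies the hypotheses with Φ = id and certificate A = 0, B = −1, D = x+y+1. [difficulty: XL] (why
it might fail: Only if the generic-point transfer hides a gap: the Nash identity g dx∧dy =
±d((F∘Φ)dΦ₁) (valid on a ball where Φ is smooth with det ≠ 0 and F is smooth) must pass into the
finite extension L = ℚ(x,y)(Φ, F∘Φ) and down by (1/N)·Tr; det Φ′ ≡ 0 on the smooth locus forces p =
0 (conclusion trivial).) [Ayoub2015, Fresan2024, CressonViusos2022, Hartshorne1975,
BasuPollackRoy2006, BochnakCosteRoy1998, KontsevichZagier2001]
#3 OneStepDescentExactDimOne (crux) — Theorem A, n = 1 (the catalogued barrier for EVERY rational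
integrand and EVERY Nash coordinate, card N2 "TheoremA_n1"): if [(0,1), p/q] reaches a constant
(0-dimensional representation) by null-modification → one change of variables (either orientation) →
null-modification → one Newton–Leibniz step, then p/q has a rational primitive over ℚ: p·D² = q·(A′D
− A·D′) with D ≠ 0 (all residues of (p/q)dx vanish). The barrier
noSemialgebraicPrimitive_inv_sub_two is the instance p = 1, q = X−2, Φ = id; 1/(x+1)² (A = −1, D =
x+1) shows non-vacuity. First rung for provers: the same trace mechanism with one derivation.
[difficulty: L] (why it might fail: The algebra (Tr commutes with the extended derivation;
derivatives in ℚ(x) have no simple poles, Rosenlicht1976) is textbook; the risk is formal: the germ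
field of semialgebraic functions at a generic point of (0,1) and `IsSemialgebraicMapOn` ⇒ algebraic
over ℚ(x) are not yet in tree.) [Ayoub2015, Fresan2024, Rosenlicht1976, BasuPollackRoy2006,
KontsevichZagier2001]
#4 ExactDescentBox (crux) — Theorem B on boxes = the ENGINE (card N3): on an open box ∏(aᵢ,bᵢ) ⊂
ℝⁿ⁺¹, if the integrand is an explicit divergence Σᵢ ∂ᵢAᵢ with potentials Aᵢ ℚ-semialgebraic and
continuous on the CLOSED box, ∂ᵢAᵢ existing on the open box, ℚ-semialgebraic and absolutely
integrable there, then [r] minus the sum of the n+1 face representations [face box, Aᵢ(xᵢ = bᵢ) −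
Aᵢ(xᵢ = aᵢ)] lies in KZ.relations (integrand additivity n times; per i a permutation change of
variables putting i last, a null adjustment to the closed-fibre band, one Newton–Leibniz move).
Gauss–Ostrogradsky with semialgebraic potentials is thus ONE derived move; by Theorem A it is
available exactly on {c = 0}. Absolute integrability of the pieces is where Theorem B is subtle in
general (card: 1/(1+x²+y²)² on ℝ² splits into conditionally convergent pieces, 0 + 0 ≠ π) — on a
bounded box with potentials continuous up to the boundary it holds, which is why the box is the
first rung. [difficulty: M] (why it might fail: Mathematically Fubini + FTC per coordinate; it
breaks only on side conditions: closed-fibre band vs open box (null faces via domainAddRel),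
ℚ-semialgebraicity of Aᵢ∘π⁻¹ on the permuted band and of the face integrands (composition facts),
Finset-sum bookkeeping in FreeAbelianGroup.) [KontsevichZagier2001, BochnakCosteRoy1998,
HuberMullerStach2017]
#5 DivergenceKernelConjecture (crux) — OPEN CORE (summit-strength): the period conjecture for the
calculus ENLARGED by the box-divergence rule of ExactDescentBox — every subgroup R ≥ KZ.relations
closed under that rule contains ker KZ.eval (phrased over R, as LogKernelConjecture in route
LiouvilleUnfolding, to avoid a second copy of the rule as a set). KZKernelConjecture ⇒ it trivially;
it ∧ ExactDescentBox ⇒ KZKernelConjecture (R := relations) — the Assembly. Its point: positive items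
of every KontsevichZagierPeriods route may be proved with the divergence theorem on boxes as ONE
admissible move, and the invariant c tells provers in advance whether an integrand is eligible (c =
0) or every chain must first go UP in dimension (c ≠ 0: ζ(2), Catalan's triangle rep, every Aomoto
dilogarithm square). [deps: ExactDescentBox] [difficulty: open-problem] (why it might fail:
Summit-strength: modulo ExactDescentBox it is equivalent to KZKernelConjecture, so the strength
barriers kzConjecture_implies_oddZetaAlgIndep / _twoPiI_log / _ellipticPeriods apply verbatim; Neg's
pressure points (regularisation, Γ-detours) are untouched by divergences.) [KontsevichZagier2001,
HuberMullerStach2017, Ayoub2015, CressonViusos2022]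
#9 HyperbolaFormNotExact (support) — the algebraic heart of ζ(2)'s no-go: dx∧dy/(1−xy) is NOT exact
over ℚ(x,y) — no polynomials A, B, D ≠ 0 with D² = (1−xy)(A₀D − A·D₀ + B₁D − B·D₁). Proof on paper
(planner): in the coordinates (x, q = 1−xy) of the same field, ω = −dx∧dq/(xq); for η = α dx + β dq,
dη = (∂ₓβ − ∂_qα) dx∧dq; the residue functional res_q : ℚ(x)((q)) → ℚ(x) kills ∂_q and commutes with
∂ₓ, giving (res_q β)′ = −1/x in ℚ(x), impossible (a derivative in ℚ(x) has no simple pole).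
Equivalently [ω] generates H²_dR(𝔸²∖{xy=1}) ≅ H¹_dR(𝔾_m) ≠ 0 and H²(U) ↪ H²(ℚ(x,y)) for opens U ⊆ 𝔸²
(Gysin kernels are classes of curves, zero on 𝔸²). [difficulty: provable-now] [Dimca1992,
Hartshorne1975, Rosenlicht1976, BostanLairezSalvy2013]
#9 ZetaTwoSquareStuck (support) — the card's headline (new theorem): THE SQUARE INTEGRAL FOR ζ(2) =
∫∫_{(0,1)²} dxdy/(1−xy) ADMITS NO DESCENT null-modification → change of variables (either
orientation of rule 2) → null-modification → single Newton–Leibniz move to ANY 1-dimensional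
representation, in any ℚ-Nash coordinate system (Kontsevich–Zagier's Calabi chain indeed goes
sideways to a product representation, never down). Glue: OneStepDescentExact at (p, q) = (1, 1 −
X₀X₁) plus HyperbolaFormNotExact (the λ-term typechecks in the planner's Sketch.lean). First
calibration point for the height statistics of cards every-valley-is-a-peak /
height-one-is-de-rham-spectator-slicing and for route Neg's item 0313 (what c can and cannot refute:
it constrains chain SHAPE, never existence). [difficulty: L] [KontsevichZagier2001, Ayoub2015,
Fresan2024]
#9 ParabolaDescends (support) — calibration of the engine on the card's positive example (c = 0 with
a CURVED polar divisor, so "primitives are transcendental" is not the obstruction in dimension 2):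
[(0,1)², 1/(y−x²−5)] − [(0,1), 1/(t−6)] − [(0,1), 2t²(1/(t²+5) − 1/(t²+4))] ∈ KZ.relations, via the
potentials A₀ = x/H, A₁ = 2x²/H (H = y−x²−5 ∈ [−6,−4] on the closed square; ∂ₓA₀ + ∂_yA₁ = 1/H) and
ExactDescentBox with n = 1 (then merge nothing: the two face reps are the two 1-dim terms; the faces
x = 0 and y-terms vanish as computed). Numerics (planner, midpoint 1200² / 2·10⁵ nodes):
−0.2084178433 = ln(5/6) − 0.0260962851 = −0.2084178419 (diff 1.4e−9). [difficulty: M]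
[KontsevichZagier2001]

TWO-LAYER PLAN. Foreseen glued splits (k ≤ 3, depth 1), nothing filed now: OneStepDescentExact ⇐
NashGermsTransfer (move data ⇒ p/q =
∂₀β − ∂₁α inside a finite extension L of ℚ(x,y) carrying the two extended derivations; stated over
an abstract field) →
TraceDescent (exactness descends along finite separable extensions: Algebra.trace commutes with
extended derivations; pure
algebra) → OneStepDescentExact; OneStepDescentExactDimOne ⇐ the same two lemmas with one derivation;
ZetaTwoSquareStuck ⇐
OneStepDescentExact(1, 1−X₀X₁) → HyperbolaFormNotExact → ZetaTwoSquareStuck (glue typechecked);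
ExactDescentBox ⇐
SingleCoordinateDescent (one i: permutation CoV + closed band + one NL) → additivity bookkeeping →
ExactDescentBox.

KILL CRITERIA. An explicit change-of-variables + single-Newton–Leibniz descent of ζ(2)'s square — or
of ANY [(0,1)², p/q] whose form is
not exact over ℚ(x,y) — refutes OneStepDescentExact and the invariant itself: close
`refuted:OneStepDescentExact` (the card
dies with it). Refutation of ExactDescentBox can only be a side-condition defect of the typed
statement: restate (pivot), do
not close. HyperbolaFormNotExact refuted = an arithmetic slip: re-witness ZetaTwoSquareStuck with
[disc, 1/(1+x²+y²)]
(conic with two points at infinity, c ≠ 0). DivergenceKernelConjecture refuted ⇒ with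
ExactDescentBox proved,
¬KZKernelConjecture ⇒ the summit is false (hand the witness to route Neg). KZKernelConjecture proved
elsewhere moots crux 5
but not cruxes 2–4.

NOT DECOMPOSED YET. (i) Theorem A for general n and for algebraic (non-rational) integrands — needs
the exactness predicate for top forms over
FractionRing (MvPolynomial (Fin n) ℚ) (definition request D1) and, for the invariant c itself,
algebraic de Rham cohomology
of a function field (not in Mathlib); (ii) Theorem A after finite SPLITTINGS (rules 1a/1b before the
descent: the argument
is additive in the compositum, not yet typed); (iii) Theorem B beyond boxes: bounded ℚ-semialgebraic
domains (needs CAD with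
continuous sections, the same missing fact as GaussManinCertificates.KZStokes) and
unbounded/singular cases with the
absolute-integrability proviso (compactify by a rule-2 move first: the card's [ℝ², 1/(1+x²+y²)²] ~
value π in 4 moves);
(iv) HeightZeroCriterion (card N4: "no rep of dimension > dim r in the chain ⟺ c(r) = 0") — needs c
as a Lean object and an
additive bookkeeping 1_σ ⊗ c(g) up to change-of-variables coinvariants, whose non-collapse is itself
open; (v) the
ResidueDecider (Griffiths–Dwork / BostanLairezSalvy2013 reduction computing c and the potentials η
for rational integrands,
n = 2) as a kit tool feeding collision-census / period-atlas certificate search; (vi) the proposed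
barrier-catalogue file
GenericPointClass.lean (librarian/refuter business). Expansion only after crux 2, 3 or 4 closes.

CHEAPEST FALSIFIER. Try to descend ζ(2)'s square in one step: for the classical substitutions Φ =
(x, xy), (xy, y/x), (x, (1−xy)),
((1−x)/(1−xy), ·) the transported integrand g′ = 1/((1−t)u)-type always needs a logarithmic fibre
primitive — consistent
with ZetaTwoSquareStuck; a refuter with kit should (a) run a Griffiths–Dwork / linear-algebra search
for (A, B) with
D = (1−xy)^k x^m, deg ≤ 8, confirming no certificate (the residue proof says none exists for any D),
and (b) look up whether
"one Stokes step ⟺ exactness at the generic point" is already printed in Ayoub2015 §1 / Fresan2024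
§3 / ViuSos2021 (it was
not found in the held texts this session). Planner ran: numerics of ParabolaDescends (agree to
1.4e−9) and `lean check` of
all eight statements + the Assembly proof (rc 0).

NUMBERS. ζ(2) = 1.6449340668…; dxdy/(1−xy) = (dq/q)∧(dx/x), q = 1−xy; H²_dR(𝔸²∖{xy = 1}) ≅
H¹_dR(𝔾_m)(−1) is 1-dimensional
(Dimca1992 Ch. 6); ParabolaDescends: ∫∫_{(0,1)²} dxdy/(y−x²−5) = −0.2084178433 (midpoint 1200²),
ln(5/6) = −0.1823215568,
∫₀¹ 2t²(1/(t²+5) − 1/(t²+4)) dt = −0.0260962851, sum −0.2084178419. Items at open: 8 (4 cruxes, 3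
support, 1 assembly).

DEFINITION REQUESTS. D1 (to file after open, for OneStepDescentExact): `IsExactRationalTopForm n (f
: FractionRing (MvPolynomial (Fin n) ℚ))`
:= ∃ A : Fin n → FractionRing (MvPolynomial (Fin n) ℚ), f = Σᵢ ∂ᵢ(A i) (pderiv extended to the
fraction field) — lets
Theorem A be stated for all n and replaces the ad hoc (A, B, D) certificates; topic
Literature/NumberTheory/Transcendental.
Foreseen Literature facts (ride as `--supports` lemmas, not items): Nash/semialgebraic functions of
k variables satisfy a
non-zero polynomial identity (BasuPollackRoy2006 Prop. 2.86, k-variable analogue by the same proof);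
trace of a finite
separable extension commutes with the unique extension of a derivation.

Novelty: Searches (2026-08-15): `lit search --hybrid "algebraic de Rham cohomology function field exact
rational differential form
divergence criterion"` (15 docs: AndreBaldassarri2001, Hartshorne1970, CattaniElZeinGriffithsLe2014,
AomotoKita2011 …);
`lit search --hybrid "Picard double integrals second kind algebraic surface reduction"` (12, only
Dieudonné's history
relevant); `lit search --hybrid "unramified cohomology generic point algebraic de Rham coniveau
Bloch Ogus"` (10:
Jannsen1988, AndreBaldassarri2001, Hartshorne1970); `lit search --source crossref "creative
telescoping rational functions
Griffiths Dwork"` (8: BostanLairezSalvy2013 doi:10.1145/2465506.2465935, Bostan–Chen–Chyzak–Li 2010,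
Lairez); `lit galaxy
search "de Rham cohomology of the function field" --star all` (0 relevant) and `--star panama
--title-contains algebraic
"integrals of the second kind"` (3 classical books: Hodge–Pedoe, Hirzebruch, Lefschetz symposium);
`lit read` of
BasuPollackRoy2006 p. 122 (Prop. 2.86) and Dimca1992 Ch. 6 (Thm. 1.21) / Ch. 2 ((2.14)); arXiv /
Semantic Scholar /
OpenAlex / zbMATH remote tiers answered HTTP 429 (rate-limited) all session — recorded; the card's
own corpus grep
(coniveau|Gysin|second kind|generic point: 24 files, incidental) stands.
Nearest prior art found: the catalogued barrier Ayoub2015 Rem. 1.2 = Fresan2024 Rem. 3.6 =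
CressonViusos2022 §2.1 (n = 1,
one integrand, identity coordinate, "not a no-go"); BostanLairezSalvy2013 / Lairez2015 /
Griffiths1969 (pole-order
reduct  [refs: 10.1145/2465506.2465935, 0804.1660, doi:10.1145/2465506.2465935, Hartshorne1970, CattaniElZeinGriffithsLe2014, AomotoKita2011, BostanLairezSalvy2013, BasuPollackRoy2006, Dimca1992, Ayoub2015, Fresan2024, CressonViusos2022, Lairez2015, Griffiths1969, Brown2009, Hartshorne1975, BlochOgus1974]

Barriers (technique_class: coniveau-residue, one-step-descent, trace-descent): - technique_class: coniveau-residue, one-step-descent, trace-descent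
- Literature.Barriers.KontsevichZagierPeriods.noSemialgebraicPrimitive_inv_sub_two: not evaded —
ENGAGED AND SHARPENED: crux 3 is this barrier for every rational integrand and every Nash coordinate
(the barrier = p/q = 1/(t−2), Φ = id, where the certificate fails by the residue at t = 2), crux 2
its dimension-2 form; the line replaces the scope caveat ("an example defeating one proof strategy,
not a no-go") by a criterion per representation, and the engine (crux 4) is exactly the
complementary locus {c = 0} where primitive-elimination IS available inside the rules.
- Literature.Barriers.KontsevichZagierPeriods.kzConjecture_implies_oddZetaAlgIndep: applies verbatim
to crux 5 only (open core, admitted summit-strength); cruxes 2–4 and the supports prove no identity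
between periods and no transcendence — they constrain chain SHAPE (c is not additive on FormalRep,
so it can never refute or prove the summit).
- Literature.Barriers.KontsevichZagierPeriods.kzConjecture_implies_twoPiI_log_algIndep: same —
inherited by crux 5 only.
- Literature.Barriers.KontsevichZagierPeriods.kzConjecture_implies_ellipticPeriods_algIndep: same —
inherited by crux 5 only.
- Literature.Barriers.KontsevichZagierPeriods.cressonViuSos_prop_3_2: not engaged — no global
semialgebraic/PL maps between domains are posited; everything is local at the generic point or
fibrewise on boxes.
- Literature.Barriers.KontsevichZagierPeriods.not_complete

History (route lifecycle, newest last):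
- 2026-08-24T06:30:35Z · DORMANT — reconciler: no traction for 6.6 d (last activity item-proof-filed at 2026-08-17T16:03:03Z); parked, not closed — `ledger route dormant route-KontsevichZagierPer (operator:999:3708788)

sub-problem: KontsevichZagierPeriods · status: dormant · opened planner-plancard-KontsevichZagierPeriods-Kont-6776ff7d-0 2026-08-15T11:33:43Z · rev 1 · ledger route-KontsevichZagierPeriods-GenericPointClass
GENERATED by the gate from the ledger (D-0016/17). Provers cite these decls: `theorem foo : Summit.KontsevichZagierPeriods.KontsevichZagierPeriods.Theses.GenericPointClass.<Decl> := …` in Summits/KontsevichZagierPeriods/KontsevichZagierPeriods/Theorems/<Name>.lean.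
-/

namespace Summit.KontsevichZagierPeriods.KontsevichZagierPeriods.Theses.GenericPointClass

open scoped BigOperators Topology Manifold Classical MeasureTheory ProbabilityTheory Matrix InnerProductSpace ComplexConjugate ContinuousMap
open Filter Set Function TopologicalSpace MeasureTheory

attribute [summit_statement] _root_.KontsevichZagierPeriods

open Literature Periods

/-- item stmt-KontsevichZagierPeriods-4425 · crux · rank 2 · open · by planner
why it might fail: Only if the generic-point transfer hides a gap: the Nash identity g dx∧dy = ±d((F∘Φ)dΦ₁) (valid on a ball where Φ is smooth with det ≠ 0 and F is smooth) must pass into the finite extension L = ℚ(x,y)(Φ, F∘Φ) and down by (1/N)·Tr; det Φ′ ≡ 0 on the smooth locus forces p = 0 (conclusion trivial).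
sources: Ayoub2015, Fresan2024, CressonViusos2022, Hartshorne1975, BasuPollackRoy2006, BochnakCosteRoy1998
[crux] Theorem A, n = 2, rational integrands (card N2): if the KZ representation [(0,1)², p/q] (q ≠
0 on the open square) is connected to a 1-dimensional representation by a chain null-modification →
ONE change of variables (rule 2 in either orientation, any ℚ-semialgebraic injective differentiable
Φ, so any Nash coordinate system incl. permutations) → null-modification → ONE Newton–Leibniz step
(rule 3), then (p/q)·dx∧dy is exact over ℚ(x,y): p/q = ∂₀(A/D) + ∂₁(B/D), i.e. p·D² = q·(A₀D − A·D₀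
+ B₁D − B·D₁) for polynomials A, B, D ≠ 0 over ℚ. Null-modifications (symmetric difference of
domains Lebesgue-null, integrands equal on the intersection) are exactly what rules (1a) with null
pieces provide and are needed for non-vacuity (rule 3 wants closed fibres, rule 2 maps open sets to
open sets); e.g. [(0,1)², 1/(x+y+1)²] satisfies the hypotheses with Φ = id and certificate A = 0, B
= −1, D = x+y+1. [difficulty: XL] -/
@[route_item "route-KontsevichZagierPeriods-GenericPointClass"]
def OneStepDescentExact : Prop :=
  ∀ (p q : MvPolynomial (Fin 2) ℚ) (r r₀ r₁ r₂ : Literature.NumberTheory.Transcendental.KZ.IntegralRep 2) (r' : Literature.NumberTheory.Transcendental.KZ.IntegralRep 1), r.domain = {x | ∀ i, x i ∈ Set.Ioo (0:ℝ) 1} → (∀ x ∈ r.domain, MvPolynomial.aeval x q ≠ 0) → Set.EqOn r.integrand (fun x => MvPolynomial.aeval x p / MvPolynomial.aeval x q) r.domain → MeasureTheory.volume (symmDiff r.domain r₀.domain) = 0 → Set.EqOn r.integrand r₀.integrand (r.domain ∩ r₀.domain) → (Literature.NumberTheory.Transcendental.KZ.of r₀ - Literature.NumberTheory.Transcendental.KZ.of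 r₁ ∈ Literature.NumberTheory.Transcendental.KZ.changeOfVariablesRel ∨ Literature.NumberTheory.Transcendental.KZ.of r₁ - Literature.NumberTheory.Transcendental.KZ.of r₀ ∈ Literature.NumberTheory.Transcendental.KZ.changeOfVariablesRel) → MeasureTheory.volume (symmDiff r₁.domain r₂.domain) = 0 → Set.EqOn r₁.integrand r₂.integrand (r₁.domain ∩ r₂.domain) → Literature.NumberTheory.Transcendental.KZ.of r₂ - Literature.NumberTheory.Transcendental.KZ.of r' ∈ Literature.NumberTheory.Transcendental.KZ.newtonLeibnizRel → ∃ (A B D : MvPolynomial (Fin 2) ℚ), D ≠ 0 ∧ p * D ^ 2 = q * (MvPolynomial.pderiv 0 A * D - A * MvPolynomial.pderiv 0 D + MvPolynomial.pderiv 1 B * D - B * MvPolynomial.pderiv 1 D)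

/-- item stmt-KontsevichZagierPeriods-4426 · crux · rank 3 · open · by planner
why it might fail: The algebra (Tr commutes with the extended derivation; derivatives in ℚ(x) have no simple poles, Rosenlicht1976) is textbook; the risk is formal: the germ field of semialgebraic functions at a generic point of (0,1) and `IsSemialgebraicMapOn` ⇒ algebraic over ℚ(x) are not yet in tree.
sources: Ayoub2015, Fresan2024, Rosenlicht1976, BasuPollackRoy2006, KontsevichZagier2001
[crux] Theorem A, n = 1 (the catalogued barrier for EVERY rational integrand and EVERY Nash
coordinate, card N2 "TheoremA_n1"): if [(0,1), p/q] reaches a constant (0-dimensional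
representation) by null-modification → one change of variables (either orientation) →
null-modification → one Newton–Leibniz step, then p/q has a rational primitive over ℚ: p·D² = q·(A′D
− A·D′) with D ≠ 0 (all residues of (p/q)dx vanish). The barrier
noSemialgebraicPrimitive_inv_sub_two is the instance p = 1, q = X−2, Φ = id; 1/(x+1)² (A = −1, D =
x+1) shows non-vacuity. First rung for provers: the same trace mechanism with one derivation.
[difficulty: L] -/
@[route_item "route-KontsevichZagierPeriods-GenericPointClass"]
def OneStepDescentExactDimOne : Prop :=
  ∀ (p q : MvPolynomial (Fin 1) ℚ) (r r₀ r₁ r₂ : Literature.NumberTheory.Transcendental.KZ.IntegralRep 1) (r' : Literature.NumberTheory.Transcendental.KZ.IntegralRep 0), r.domain = {x | ∀ i, x i ∈ Set.Ioo (0:ℝ) 1} → (∀ x ∈ r.domain, MvPolynomial.aeval x q ≠ 0) → Set.EqOn r.integrand (fun x => MvPolynomial.aeval x p / MvPolynomial.aeval x q) r.domain → MeasureTheory.volume (symmDiff r.domain r₀.domain) = 0 → Set.EqOn r.integrand r₀.integrand (r.domain ∩ r₀.domain) → (Literature.NumberTheory.Transcendental.KZ.of r₀ - Literature.NumberTheory.Transcendental.KZ.of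 r₁ ∈ Literature.NumberTheory.Transcendental.KZ.changeOfVariablesRel ∨ Literature.NumberTheory.Transcendental.KZ.of r₁ - Literature.NumberTheory.Transcendental.KZ.of r₀ ∈ Literature.NumberTheory.Transcendental.KZ.changeOfVariablesRel) → MeasureTheory.volume (symmDiff r₁.domain r₂.domain) = 0 → Set.EqOn r₁.integrand r₂.integrand (r₁.domain ∩ r₂.domain) → Literature.NumberTheory.Transcendental.KZ.of r₂ - Literature.NumberTheory.Transcendental.KZ.of r' ∈ Literature.NumberTheory.Transcendental.KZ.newtonLeibnizRel → ∃ (A D : MvPolynomial (Fin 1) ℚ), D ≠ 0 ∧ p * D ^ 2 = q * (MvPolynomial.pderiv 0 A * D - A * MvPolynomial.pderiv 0 D)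

/-- item stmt-KontsevichZagierPeriods-4427 · crux · rank 4 · open · by planner
why it might fail: Mathematically Fubini + FTC per coordinate; it breaks only on side conditions: closed-fibre band vs open box (null faces via domainAddRel), ℚ-semialgebraicity of Aᵢ∘π⁻¹ on the permuted band and of the face integrands (composition facts), Finset-sum bookkeeping in FreeAbelianGroup.
sources: KontsevichZagier2001, BochnakCosteRoy1998, HuberMullerStach2017
[crux] Theorem B on boxes = the ENGINE (card N3): on an open box ∏(aᵢ,bᵢ) ⊂ ℝⁿ⁺¹, if the integrand
is an explicit divergence Σᵢ ∂ᵢAᵢ with potentials Aᵢ ℚ-semialgebraic and continuous on the CLOSED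
box, ∂ᵢAᵢ existing on the open box, ℚ-semialgebraic and absolutely integrable there, then [r] minus
the sum of the n+1 face representations [face box, Aᵢ(xᵢ = bᵢ) − Aᵢ(xᵢ = aᵢ)] lies in KZ.relations
(integrand additivity n times; per i a permutation change of variables putting i last, a null
adjustment to the closed-fibre band, one Newton–Leibniz move). Gauss–Ostrogradsky with semialgebraic
potentials is thus ONE derived move; by Theorem A it is available exactly on {c = 0}. Absolute
integrability of the pieces is where Theorem B is subtle in general (card: 1/(1+x²+y²)² on ℝ² splits
into conditionally convergent pieces, 0 + 0 ≠ π) — on a bounded box with potentials continuous up to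
the boundary it holds, which is why the box is the first rung. [difficulty: M] -/
@[route_item "route-KontsevichZagierPeriods-GenericPointClass", crux]
def ExactDescentBox : Prop :=
  ∀ (n : ℕ) (a b : Fin (n + 1) → ℝ) (r : Literature.NumberTheory.Transcendental.KZ.IntegralRep (n + 1)) (A A' : Fin (n + 1) → (Fin (n + 1) → ℝ) → ℝ) (s : Fin (n + 1) → Literature.NumberTheory.Transcendental.KZ.IntegralRep n), (∀ i, a i < b i) → r.domain = {z | ∀ i, z i ∈ Set.Ioo (a i) (b i)} → (∀ i, Literature.NumberTheory.Transcendental.IsSemialgebraicFunOn ℚ {z | ∀ j, z j ∈ Set.Icc (a j) (b j)} (A i)) → (∀ i, ContinuousOn (A i) {z | ∀ j, z j ∈ Set.Icc (a j) (b j)}) → (∀ i, ∀ z ∈ r.domain, HasDerivAt (fun t : ℝ => A i (Function.update z i t)) (A' i z) (z i)) → (∀ i, Literature.NumberTheory.Transcendental.IsSemialgebraicFunOn ℚ r.domain (A' i)) → (∀ i, MeasureTheory.IntegrableOn (A' i) r.domain) → Set.EqOn r.integrand (fun z => ∑ i, A' i z) r.domain → (∀ i, (s i).domain = {y | ∀ j,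 y j ∈ Set.Ioo (a (Fin.succAbove i j)) (b (Fin.succAbove i j))}) → (∀ i, Set.EqOn (s i).integrand (fun y => A i (Fin.insertNth i (b i) y) - A i (Fin.insertNth i (a i) y)) (s i).domain) → Literature.NumberTheory.Transcendental.KZ.of r - ∑ i, Literature.NumberTheory.Transcendental.KZ.of (s i) ∈ Literature.NumberTheory.Transcendental.KZ.relations

/-- item stmt-KontsevichZagierPeriods-4428 · crux · rank 5 · open · by planner
why it might fail: Summit-strength: modulo ExactDescentBox it is equivalent to KZKernelConjecture, so the strength barriers kzConjecture_implies_oddZetaAlgIndep / _twoPiI_log / _ellipticPeriods apply verbatim; Neg's pressure points (regularisation, Γ-detours) are untouched by divergences.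
sources: KontsevichZagier2001, HuberMullerStach2017, Ayoub2015, CressonViusos2022
[crux] OPEN CORE (summit-strength): the period conjecture for the calculus ENLARGED by the
box-divergence rule of ExactDescentBox — every subgroup R ≥ KZ.relations closed under that rule
contains ker KZ.eval (phrased over R, as LogKernelConjecture in route LiouvilleUnfolding, to avoid a
second copy of the rule as a set). KZKernelConjecture ⇒ it trivially; it ∧ ExactDescentBox ⇒
KZKernelConjecture (R := relations) — the Assembly. Its point: positive items of every
KontsevichZagierPeriods route may be proved with the divergence theorem on boxes as ONE admissible
move, and the invariant c tells provers in advance whether an integrand is eligible (c = 0) or every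
chain must first go UP in dimension (c ≠ 0: ζ(2), Catalan's triangle rep, every Aomoto dilogarithm
square). [deps: ExactDescentBox] [difficulty: open-problem] -/
@[route_item "route-KontsevichZagierPeriods-GenericPointClass", crux]
def DivergenceKernelConjecture : Prop :=
  ∀ (R : AddSubgroup Literature.NumberTheory.Transcendental.KZ.FormalRep), Literature.NumberTheory.Transcendental.KZ.relations ≤ R → (∀ (n : ℕ) (a b : Fin (n + 1) → ℝ) (r : Literature.NumberTheory.Transcendental.KZ.IntegralRep (n + 1)) (A A' : Fin (n + 1) → (Fin (n + 1) → ℝ) → ℝ) (s : Fin (n + 1) → Literature.NumberTheory.Transcendental.KZ.IntegralRep n), (∀ i, a i < b i) → r.domain = {z | ∀ i, z i ∈ Set.Ioo (a i) (b i)} → (∀ i, Literature.NumberTheory.Transcendental.IsSemialgebraicFunOn ℚ {z | ∀ j, z j ∈ Set.Icc (a j) (b j)} (A i)) → (∀ i, ContinuousOn (A i) {z | ∀ j, z j ∈ Set.Icc (a j) (b j)}) → (∀ i, ∀ z ∈ r.domain, HasDerivAt (fun t : ℝ => A i (Function.update z i t)) (A' i z) (z i)) → (∀ i, Literature.NumberTheory.Transcendental.IsSemialgebraicFunOn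 ℚ r.domain (A' i)) → (∀ i, MeasureTheory.IntegrableOn (A' i) r.domain) → Set.EqOn r.integrand (fun z => ∑ i, A' i z) r.domain → (∀ i, (s i).domain = {y | ∀ j, y j ∈ Set.Ioo (a (Fin.succAbove i j)) (b (Fin.succAbove i j))}) → (∀ i, Set.EqOn (s i).integrand (fun y => A i (Fin.insertNth i (b i) y) - A i (Fin.insertNth i (a i) y)) (s i).domain) → Literature.NumberTheory.Transcendental.KZ.of r - ∑ i, Literature.NumberTheory.Transcendental.KZ.of (s i) ∈ R) → ∀ c : Literature.NumberTheory.Transcendental.KZ.FormalRep, Literature.NumberTheory.Transcendental.KZ.eval c = 0 → c ∈ R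

/-- item stmt-KontsevichZagierPeriods-4429 · support · rank 9 · closed · proved by Summit.KontsevichZagierPeriods.GenericPointClass.hyperbolaFormNotExact_proof @ 45ee9bb9bd29 (prover) · by planner
sources: Dimca1992, Hartshorne1975, Rosenlicht1976, BostanLairezSalvy2013
[support] the algebraic heart of ζ(2)'s no-go: dx∧dy/(1−xy) is NOT exact over ℚ(x,y) — no
polynomials A, B, D ≠ 0 with D² = (1−xy)(A₀D − A·D₀ + B₁D − B·D₁). Proof on paper (planner): in the
coordinates (x, q = 1−xy) of the same field, ω = −dx∧dq/(xq); for η = α dx + β dq, dη = (∂ₓβ − ∂_qα)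
dx∧dq; the residue functional res_q : ℚ(x)((q)) → ℚ(x) kills ∂_q and commutes with ∂ₓ, giving (res_q
β)′ = −1/x in ℚ(x), impossible (a derivative in ℚ(x) has no simple pole). Equivalently [ω] generates
H²_dR(𝔸²∖{xy=1}) ≅ H¹_dR(𝔾_m) ≠ 0 and H²(U) ↪ H²(ℚ(x,y)) for opens U ⊆ 𝔸² (Gysin kernels are classes
of curves, zero on 𝔸²). [difficulty: provable-now] -/
@[route_item "route-KontsevichZagierPeriods-GenericPointClass"]
def HyperbolaFormNotExact : Prop :=
  ¬ ∃ (A B D : MvPolynomial (Fin 2) ℚ), D ≠ 0 ∧ D ^ 2 = (1 - MvPolynomial.X 0 * MvPolynomial.X 1) * (MvPolynomial.pderiv 0 A * D - A * MvPolynomial.pderiv 0 D + MvPolynomial.pderiv 1 B * D - B * MvPolynomial.pderiv 1 D)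

/-- item stmt-KontsevichZagierPeriods-4430 · support · rank 9 · open · by planner
sources: KontsevichZagier2001, Ayoub2015, Fresan2024
[support] the card's headline (new theorem): THE SQUARE INTEGRAL FOR ζ(2) = ∫∫_{(0,1)²} dxdy/(1−xy)
ADMITS NO DESCENT null-modification → change of variables (either orientation of rule 2) →
null-modification → single Newton–Leibniz move to ANY 1-dimensional representation, in any ℚ-Nash
coordinate system (Kontsevich–Zagier's Calabi chain indeed goes sideways to a product
representation, never down). Glue: OneStepDescentExact at (p, q) = (1, 1 − X₀X₁) plus
HyperbolaFormNotExact (the λ-term typechecks in the planner's Sketch.lean). First calibration point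
for the height statistics of cards every-valley-is-a-peak / height-one-is-de-rham-spectator-slicing
and for route Neg's item 0313 (what c can and cannot refute: it constrains chain SHAPE, never
existence). [difficulty: L] -/
@[route_item "route-KontsevichZagierPeriods-GenericPointClass"]
def ZetaTwoSquareStuck : Prop :=
  ∀ (r r₀ r₁ r₂ : Literature.NumberTheory.Transcendental.KZ.IntegralRep 2) (r' : Literature.NumberTheory.Transcendental.KZ.IntegralRep 1), r.domain = {x | ∀ i, x i ∈ Set.Ioo (0:ℝ) 1} → Set.EqOn r.integrand (fun x => 1 / (1 - x 0 * x 1)) r.domain → MeasureTheory.volume (symmDiff r.domain r₀.domain) = 0 → Set.EqOn r.integrand r₀.integrand (r.domain ∩ r₀.domain) → (Literature.NumberTheory.Transcendental.KZ.of r₀ - Literature.NumberTheory.Transcendental.KZ.of r₁ ∈ Literature.NumberTheory.Transcendental.KZ.changeOfVariablesRel ∨ Literature.NumberTheory.Transcendental.KZ.of r₁ - Literature.NumberTheory.Transcendental.KZ.of r₀ ∈ Literature.NumberTheory.Transcendental.KZ.changeOfVariablesRel) → MeasureTheory.volume (symmDiff r₁.domain r₂.domain) = 0 → Set.EqOn r₁.integrand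 r₂.integrand (r₁.domain ∩ r₂.domain) → Literature.NumberTheory.Transcendental.KZ.of r₂ - Literature.NumberTheory.Transcendental.KZ.of r' ∉ Literature.NumberTheory.Transcendental.KZ.newtonLeibnizRel

/-- item stmt-KontsevichZagierPeriods-4431 · support · rank 9 · closed · proved by Summit.KontsevichZagierPeriods.GenericPointClass.parabolaDescends_proof @ 0d1f68833b96 (prover) · by planner
sources: KontsevichZagier2001
[support] calibration of the engine on the card's positive example (c = 0 with a CURVED polar
divisor, so "primitives are transcendental" is not the obstruction in dimension 2): [(0,1)²,
1/(y−x²−5)] − [(0,1), 1/(t−6)] − [(0,1), 2t²(1/(t²+5) − 1/(t²+4))] ∈ KZ.relations, via the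
potentials A₀ = x/H, A₁ = 2x²/H (H = y−x²−5 ∈ [−6,−4] on the closed square; ∂ₓA₀ + ∂_yA₁ = 1/H) and
ExactDescentBox with n = 1 (then merge nothing: the two face reps are the two 1-dim terms; the faces
x = 0 and y-terms vanish as computed). Numerics (planner, midpoint 1200² / 2·10⁵ nodes):
−0.2084178433 = ln(5/6) − 0.0260962851 = −0.2084178419 (diff 1.4e−9). [difficulty: M] -/
@[route_item "route-KontsevichZagierPeriods-GenericPointClass"]
def ParabolaDescends : Prop :=
  ∀ (r : Literature.NumberTheory.Transcendental.KZ.IntegralRep 2) (s₀ s₁ : Literature.NumberTheory.Transcendental.KZ.IntegralRep 1), r.domain = {z | ∀ i, z i ∈ Set.Ioo (0:ℝ) 1} → Set.EqOn r.integrand (fun z => 1 / (z 1 - z 0 ^ 2 - 5)) r.domain → s₀.domain = {y | ∀ i, y i ∈ Set.Ioo (0:ℝ) 1} → Set.EqOn s₀.integrand (fun y => 1 / (y 0 - 6)) s₀.domain → s₁.domain = {y | ∀ i, y i ∈ Set.Ioo (0:ℝ) 1} → Set.EqOn s₁.integrand (fun y => 2 * y 0 ^ 2 * (1 / (y 0 ^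 2 + 5) - 1 / (y 0 ^ 2 + 4))) s₁.domain → Literature.NumberTheory.Transcendental.KZ.of r - Literature.NumberTheory.Transcendental.KZ.of s₀ - Literature.NumberTheory.Transcendental.KZ.of s₁ ∈ Literature.NumberTheory.Transcendental.KZ.relations

/-- item stmt-KontsevichZagierPeriods-4432 · assembly · rank 1 · closed · proved by Summit.KontsevichZagierPeriods.GenericPointClass.assembly_proof @ 7343233001e8 (prover) · by planner
sources: KontsevichZagier2001, HuberMullerStach2017
[assembly] ExactDescentBox → DivergenceKernelConjecture → KontsevichZagierPeriods (one-screen proof,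
done in Sketch.lean). -/
@[route_item "route-KontsevichZagierPeriods-GenericPointClass"]
def Assembly : Prop :=
  ExactDescentBox → DivergenceKernelConjecture → KontsevichZagierPeriods

/-! D-0027 §2.1 — DECIDING THEOREM (planner-authored via `route open/edit --closes-file`; by planner-rbadge-KontsevichZagierPeriods-Generic-c2089daa-g2-0 2026-08-15T16:10:36Z):
its hypotheses are this route's items and its conclusion the sub-problem Statement (glue_lint), and it elaborates with this file. -/

@[closes "route-KontsevichZagierPeriods-GenericPointClass"] theorem closes (hB : ExactDescentBox) (hK : DivergenceKernelConjecture) : KontsevichZagierPeriods := by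
  intro n m r r' _ _ hv
  refine hK Literature.NumberTheory.Transcendental.KZ.relations le_rfl hB _ ?_
  simp [Literature.NumberTheory.Transcendental.KZ.eval_of, hv]

end Summit.KontsevichZagierPeriods.KontsevichZagierPeriods.Theses.GenericPointClass
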